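import Summits.ResolutionOfSingularities.ResolutionOfSingularities.Theorems.HilbertSamuelEliminationSigmaMaxModificationsCorridor3SigmaRowRunPChart
import HarnessLib

/-!
# [OURS · L1 W4.2] ENGINE-I «ROW-P» — THE INSTANCE, FILE D2a (kernel lane): THE `T`-GUARDED LAW `η ≤ 3` DISCHARGED ON A CONTACT CHART — at a point of the row
# stratum inside the chart's open, at most three old-epoch members pass (res-L1-w42-tri-2 FLAG B-2: «(c3) at `(I, m)` + `sncWith` + `ne_H`»)
# (cell res-hironaka, LADDER-RESOLUTION rung L; slot W4.2, crux chain w42 `SigmaMaxModificationsCorridor3` stmt-ResolutionOfSingularities-19249 / crux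
# stmt-…-18506; RULING v3.14-51a (51a-F); seat res-D-pv-060 g9; `--supports stmt-ResolutionOfSingularities-19249 --as helper`, counted 0)

HONEST FRAMING. OURS proof bookkeeping over FILE A/D1 (`RowState.eta`, `RowChart`) and o2's `ContactChart` / `SncWith`. Nothing here is a statement of H. Hironaka's
manuscript [Hironaka2017] (CANDIDATE, never a premise) nor of [Cutkosky2009]. Every declaration a PROVED `theorem`. AI-written, weaker than expert review.

THE ARGUMENT. Let `c : RowChart k m S₀ s` (first-layer chart `ch : ContactChart φ s.I m`), `x′ ∈ ch.U` with `x := ch.U.ι x′ ∈ T s`. Then `ord_x I ≥ m`, so `x′ ∈ V(H)`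
((c3), o2's `ContactChart.mem_support_of_le_idealOrder`). By `c.sncWith : HasSNC (H :: E|_U)` there is at `x′` an INJECTION of the members of `H :: E|_U` through
`x′` into the `d` slots of a regular system of parameters, `d = spanFinrank 𝔪_{x′}`; `H` is one of them and (`c.ne_H`) differs from every `B|_U`, so at most `d − 1`
distinct restricted boundary members pass through `x′`. If the restricted old-epoch list `E⁻|_U` has NO REPEATED MEMBER (hypothesis `Nodup` — tri-2's (g1) caveat:
`η` counts LIST entries) then `η(x) = #{B ∈ E⁻ : x ∈ V(B)} ≤ d − 1`, and with `d ≤ 4` (the ambient is the regular FOUR-fold of the σ-chart data — hypothesis, read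
point-wise) `η(x) ≤ 3`.

* `RowState.eta_eq_length_filter_map_comap` — `η(x)` counted on the restricted list `E⁻|_U` at `x′`.
* **`RowChart.eta_le_spanFinrank_sub_one`** — `η(x) + 1 ≤ spanFinrank 𝔪_{U,x′}` for `x = ch.U.ι x′ ∈ T s`, `E⁻|_U` without repeats.
* **`RowChart.eta_le_three`** — `… ≤ 3` when `spanFinrank 𝔪_{U,x′} ≤ 4`.

References: Bierstone–Grigoriev–Milman–Włodarczyk 2011, Def. 3.1.1 [BierstoneGrigorievMilmanWlodarczyk2011] (snc); Cutkosky 2009 Def. 5.4 («η») [Cutkosky2009].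
-/

set_option linter.dupNamespace false -- mandated namespace of this single-conjunct summit

noncomputable section

open CategoryTheory AlgebraicGeometry TopologicalSpace IsLocalRing
open Literature.AlgebraicGeometry.Resolution
open Summit.ResolutionOfSingularities.ResolutionOfSingularities.Theorems.SigmaMaxModificationsCorridor3.Sigma

namespace Summit.ResolutionOfSingularities.ResolutionOfSingularities.Theorems.SigmaMaxModificationsCorridor3.RowRunP

universe u

/-- **Counting through a point commutes with restriction to an open**: the members of `E` through `f x′` are counted by the members of `E.map (·.comap f)`
through `x′` (`support_comap`). [folklore] -/
theorem length_membersThrough_map_comap {W V : Scheme.{u}} (f : V ⟶ W) (E : List W.IdealSheafData) (x' : V) :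
    (membersThrough (E.map fun B => B.comap f) x').length = (membersThrough E (f.base x')).length := by
  classical
  simp only [membersThrough]
  rw [← List.countP_eq_length_filter, ← List.countP_eq_length_filter, List.countP_map]
  refine List.countP_congr fun B _ => ?_
  simp only [Function.comp_apply, Scheme.IdealSheafData.support_comap, TopologicalSpace.Closeds.coe_preimage, Set.mem_preimage]

/-- **A `Nodup` list filtered through a point injects into the snc slots**: if the members of `L` through `x` are pairwise distinct members of an snc family
`F` through `x`, all different from a further member `H ∈ F` through `x`, then their number is at most `spanFinrank 𝔪_x − 1`. [cite: BierstoneGrigorievMilmanWlodarczyk2011, Def. 3.1.1] -/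
theorem length_membersThrough_add_one_le_of_hasSNC {V : Scheme.{u}} {F : List V.IdealSheafData} (hF : HasSNC F) (x : V)
    (L : List V.IdealSheafData) (hL : (membersThrough L x).Nodup) (hLF : ∀ D ∈ L, D ∈ F)
    (H : V.IdealSheafData) (hHF : H ∈ F) (hxH : x ∈ (H.support : Set V)) (hne : ∀ D ∈ L, D ≠ H) :
    (membersThrough L x).length + 1 ≤ (maximalIdeal (V.presheaf.stalk x)).spanFinrank := by
  classical
  obtain ⟨-, u, -, ⟨ι, hιinj, -⟩, -⟩ := hF x
  -- the slots of the members of `L` through `x`, and the slot of `H`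
  set M := membersThrough L x with hM
  have hmem : ∀ D ∈ M, D ∈ F ∧ x ∈ (D.support : Set V) := fun D hD => by
    have h := mem_membersThrough_iff.mp hD
    exact ⟨hLF D h.1, h.2⟩
  let g : Fin M.length → Fin (maximalIdeal (V.presheaf.stalk x)).spanFinrank := fun i =>
    ι ⟨M.get i, (hmem _ (List.get_mem M i)).1, (hmem _ (List.get_mem M i)).2⟩
  have hg : Function.Injective g := by
    intro i j hij
    have h1 := hιinj hij
    have h2 : M.get i = M.get j := congrArg Subtype.val h1
    exact (List.Nodup.get_inj_iff hL).mp h2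
  let j₀ : Fin (maximalIdeal (V.presheaf.stalk x)).spanFinrank := ι ⟨H, hHF, hxH⟩
  have hgne : ∀ i, g i ≠ j₀ := by
    intro i h
    have h1 := hιinj h
    have h2 : M.get i = H := congrArg Subtype.val h1
    exact hne _ (mem_membersThrough_iff.mp (List.get_mem M i)).1 h2
  -- `g` lands in the complement of `j₀`
  let g' : Fin M.length → {j : Fin (maximalIdeal (V.presheaf.stalk x)).spanFinrank // j ≠ j₀} := fun i => ⟨g i, hgne i⟩
  have hg' : Function.Injective g' := fun i j hij => hg (congrArg Subtype.val hij)
  have hcard := Fintype.card_le_of_injective g' hg'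
  rw [Fintype.card_fin, Fintype.card_subtype_compl, Fintype.card_fin, Fintype.card_unique] at hcard
  have hpos : 0 < (maximalIdeal (V.presheaf.stalk x)).spanFinrank := Fin.pos j₀
  omega

namespace RowChart

variable {k : Type u} [Field k] {m S₀ : ℕ} {s : RowState.{u}} (c : RowChart k m S₀ s)

/-- **`η` ON THE ROW STRATUM, INSIDE A CONTACT CHART**: for `x′ ∈ ch.U` with `ch.U.ι x′ ∈ T s` and the restricted old epoch `E⁻|_U` without repeats,
`η(x) + 1 ≤ spanFinrank 𝔪_{U,x′}` (the point lies on the contact hypersurface `H` by (c3); `H :: E|_U` is snc; `H ≠ B|_U`). PROVED.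
[cite: BierstoneGrigorievMilmanWlodarczyk2011, Def. 3.1.1] [cite: Cutkosky2009, Def. 5.4 («η»)] -/
theorem eta_add_one_le_spanFinrank (x' : (c.ch.U : Scheme.{u})) (hxT : c.ch.U.ι.base x' ∈ s.T m S₀)
    (hnodup : (membersThrough (s.Eminus.map fun B => B.comap c.ch.U.ι) x').Nodup) :
    s.eta ⟨c.ch.U.ι.base x'⟩ + 1 ≤ (maximalIdeal ((c.ch.U : Scheme.{u}).presheaf.stalk x')).spanFinrank := by
  have hxH : x' ∈ (c.ch.H.support : Set (c.ch.U : Scheme.{u})) := c.ch.mem_support_of_le_idealOrder x' hxT.1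
  have heta : s.eta ⟨c.ch.U.ι.base x'⟩ = (membersThrough (s.Eminus.map fun B => B.comap c.ch.U.ι) x').length := by
    unfold RowState.eta
    exact (length_membersThrough_map_comap c.ch.U.ι s.Eminus x').symm
  rw [heta]
  refine length_membersThrough_add_one_le_of_hasSNC c.sncWith x' _ hnodup (fun D hD => ?_) c.ch.H List.mem_cons_self hxH
    (fun D hD => ?_)
  · obtain ⟨B, hB, rfl⟩ := List.mem_map.mp hD
    exact List.mem_cons_of_mem _ (List.mem_map.mpr ⟨B, List.mem_of_mem_take hB, rfl⟩)
  · obtain ⟨B, hB, rfl⟩ := List.mem_map.mp hD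
    exact c.ne_H B (List.mem_of_mem_take hB)

/-- **THE `T`-GUARDED LAW `η ≤ 3` ON A CHART of the regular FOUR-fold ambient** (`spanFinrank 𝔪_{U,x′} ≤ 4`). PROVED — the discharge res-L1-w42-tri-2 (B-2) asked
for, point-wise on the chart's open; a cover of `T` by first-layer charts makes it global (FILE D3). [cite: Cutkosky2009, Def. 5.4 («η»), Thm 7.2] -/
theorem eta_le_three (x' : (c.ch.U : Scheme.{u})) (hxT : c.ch.U.ι.base x' ∈ s.T m S₀)
    (hnodup : (membersThrough (s.Eminus.map fun B => B.comap c.ch.U.ι) x').Nodup)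
    (hdim : (maximalIdeal ((c.ch.U : Scheme.{u}).presheaf.stalk x')).spanFinrank ≤ 4) :
    s.eta ⟨c.ch.U.ι.base x'⟩ ≤ 3 := by
  have h := c.eta_add_one_le_spanFinrank x' hxT hnodup
  omega

end RowChart

end Summit.ResolutionOfSingularities.ResolutionOfSingularities.Theorems.SigmaMaxModificationsCorridor3.RowRunP

end
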